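import Mathlib

/-!
# T5DeltaTwistSymplectic — the δ-twist dictionary as kernel identities (Tier-5 support, seat p3)

Kernel witnesses behind lines already on the record: route/T5-N2-route-3.md v20 §N2.9.2, «W_GI :=
(V_v, δ(·,·)): our hermitian 3-space with its form multiplied by a trace-zero δ ∈ E_v^× is
SKEW-hermitian with the same isometry group … the symplectic space tr_{E/F}(δ⁻¹⟨·,·⟩ ⊗ δ(·,·)) =
tr_{E/F}(⟨·,·⟩ ⊗ (·,·)) is the datum's [A, one line]», and route/T5-route-3.md v0.31 §C
«δ-twist reflection (HKS §0) in A4, A6, B3».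

Model: forms as functions `V → V → E` over a field `E` with an involution `star` (E_v with its
conjugation); `trace z := z + star z` is tr_{E/F}; the symplectic form of the dual pair is read on
pure tensors, `traceForm h s (x, y) (x′, y′) := trace (h x x′ · s y y′)`.

* `traceForm_swap`, `traceForm_self` — for `h` hermitian and `s` skew-hermitian the trace form is
  skew-symmetric and vanishes on the diagonal (exactly: `h x x` is fixed and `s y y` is trace-zero;
  no characteristic assumption);
* `isSkewHermitianFn_inv_smul`, `isHermitianFn_smul` — for `δ̄ = −δ`, `δ⁻¹·h` is skew-hermitian
  and `δ·s` is hermitian (the reflection hermitian ↔ skew-hermitian);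
* **`traceForm_twist`** — `(δ⁻¹·h) ⊗ (δ·s) = h ⊗ s` pointwise: the SAME symplectic form;
* `isometry_smul_iff` — the isometries of `δ·h` are those of `h` (the function-model restatement
  of file 11's `unitaryGroup_smul`).

What stays prose: the F-bilinear extension of the trace form to V ⊗_F W (values on pure tensors
only here), the Heisenberg group and Kudla's splitting.  README §8(d): this file uses an
L-value-free non-vanishing device: NO.
-/

namespace Summit.Ventures.HodgeRepro2.T5DeltaTwistSymplectic

variable {E : Type*} [Field E] [StarRing E] {V W : Type*}

/-- `tr_{E/F} z = z + z̄`. -/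
def trace (z : E) : E := z + star z

/-- `trace` is additive. -/
theorem trace_add (z w : E) : trace (z + w) = trace z + trace w := by
  simp only [trace, star_add]
  ring

/-- `trace (star z) = trace z`. -/
theorem trace_star (z : E) : trace (star z) = trace z := by
  simp only [trace, star_star]
  ring

/-- `trace (−z) = −trace z`. -/
theorem trace_neg (z : E) : trace (-z) = -trace z := by
  simp only [trace, star_neg]
  ring

/-- A trace-zero element has `trace z = 0` (exactly). -/
theorem trace_eq_zero_of_star_eq_neg {z : E} (hz : star z = -z) : trace z = 0 := by
  simp only [trace, hz]
  ring

/-- A form `h : V → V → E` is hermitian: `h x y = star (h y x)`. -/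
def IsHermitianFn (h : V → V → E) : Prop := ∀ x y, h x y = star (h y x)

/-- A form `s : W → W → E` is skew-hermitian: `s x y = −star (s y x)`. -/
def IsSkewHermitianFn (s : W → W → E) : Prop := ∀ x y, s x y = -star (s y x)

/-- The diagonal values of a hermitian form are fixed by the involution. -/
theorem IsHermitianFn.star_self {h : V → V → E} (hh : IsHermitianFn h) (x : V) :
    star (h x x) = h x x := (hh x x).symm

/-- The diagonal values of a skew-hermitian form are trace-zero. -/
theorem IsSkewHermitianFn.star_self {s : W → W → E} (hs : IsSkewHermitianFn s) (y : W) :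
    star (s y y) = -s y y := by
  have := hs y y
  rw [eq_neg_iff_add_eq_zero] at this
  rw [eq_neg_iff_add_eq_zero, add_comm]
  exact this

/-- The symplectic trace form of the dual pair on pure tensors:
`Ω((x, y), (x′, y′)) := tr(h x x′ · s y y′)`. -/
def traceForm (h : V → V → E) (s : W → W → E) (p q : V × W) : E :=
  trace (h p.1 q.1 * s p.2 q.2)

/-- `Ω(q, p) = −Ω(p, q)` for `h` hermitian and `s` skew-hermitian. -/
theorem traceForm_swap {h : V → V → E} {s : W → W → E} (hh : IsHermitianFn h)
    (hs : IsSkewHermitianFn s) (p q : V × W) : traceForm h s q p = -traceForm h s p q := by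
  unfold traceForm
  rw [hh q.1 p.1, hs q.2 p.2, mul_neg, ← star_mul', trace_neg, trace_star]

/-- `Ω(p, p) = 0`: `h x x` is fixed and `s y y` is trace-zero, so the product is trace-zero. -/
theorem traceForm_self {h : V → V → E} {s : W → W → E} (hh : IsHermitianFn h)
    (hs : IsSkewHermitianFn s) (p : V × W) : traceForm h s p p = 0 := by
  unfold traceForm
  apply trace_eq_zero_of_star_eq_neg
  rw [star_mul', hh.star_self, hs.star_self, mul_neg]

section twist

variable (δ : E)

/-- For `δ̄ = −δ`, `δ⁻¹·h` is skew-hermitian when `h` is hermitian. -/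
theorem isSkewHermitianFn_inv_smul (hδ : star δ = -δ) {h : V → V → E} (hh : IsHermitianFn h) :
    IsSkewHermitianFn (fun x y => δ⁻¹ * h x y) := by
  intro x y
  simp only
  rw [star_mul', star_inv₀, hδ, ← hh x y, inv_neg, neg_mul, neg_neg]

/-- For `δ̄ = −δ`, `δ·s` is hermitian when `s` is skew-hermitian. -/
theorem isHermitianFn_smul (hδ : star δ = -δ) {s : W → W → E} (hs : IsSkewHermitianFn s) :
    IsHermitianFn (fun x y => δ * s x y) := by
  intro x y
  simp only
  rw [star_mul', hδ, hs x y]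
  ring

/-- THE δ-TWIST LEAVES THE SYMPLECTIC FORM UNCHANGED: `(δ⁻¹·h) ⊗ (δ·s) = h ⊗ s` pointwise. -/
theorem traceForm_twist (hδ0 : δ ≠ 0) (h : V → V → E) (s : W → W → E) :
    traceForm (fun x y => δ⁻¹ * h x y) (fun x y => δ * s x y) = traceForm h s := by
  funext p q
  unfold traceForm
  congr 1
  field_simp

omit [StarRing E] in
/-- The isometry condition is insensitive to the scaling by `δ ≠ 0`: `g` preserves `δ·h` iff it
preserves `h` (the function-model form of file 11's `unitaryGroup_smul`). -/
theorem isometry_smul_iff (hδ0 : δ ≠ 0) (h : V → V → E) (g : V → V) :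
    (∀ x y, δ * h (g x) (g y) = δ * h x y) ↔ ∀ x y, h (g x) (g y) = h x y := by
  constructor
  · intro hg x y
    exact mul_left_cancel₀ hδ0 (hg x y)
  · intro hg x y
    rw [hg x y]

end twist

end Summit.Ventures.HodgeRepro2.T5DeltaTwistSymplectic
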